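import Mathlib.Algebra.Module.ZMod
import Literature.NumberTheory.GaloisRepresentations.SerreOpenImageGroupLemmas
import HarnessLib

/-!
# Serre 1972, §1.11–1.12 (Corollaries) and §2.1: the shape of the image of inertia in `GL₂(𝔽_p)`

Topic `NumberTheory/GaloisRepresentations`.  Theorems only (nothing is defined, no named fact):
the group theory converting the *printed* conclusions of J.-P. Serre, *Propriétés galoisiennes des
points d'ordre fini des courbes elliptiques*, Invent. Math. 15 (1972), §1.11, Prop. 11 with its
Corollaire and Prop. 12 c), about the image `H` of an inertia group at `p` in
`Aut(E_p) ≅ GL₂(𝔽_p)`, into the hypotheses of §2 (Prop. 14, Prop. 17) used in §4.2 of the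
proof of the open image theorem (the tree's named fact
`Literature.NumberTheory.EllipticCurves.serre_open_image`):

* `Serre1972.exists_isField_eq_unitGroup_of_isCyclic` — **Prop. 12 c) ⇒ "sous-groupe de Cartan
  non déployé"**: a cyclic subgroup of `GL₂(𝔽_p)` of order `p² - 1` is the non-split Cartan
  subgroup `kˣ` of a subalgebra `k ⊆ M₂(𝔽_p)` which is a field with `p²` elements (n° 2.1 b:
  "le sous-groupe `k*` de `GL(V)` est cyclique d'ordre `p² - 1`", and conversely by counting:
  `H = ⟨g⟩ ⊆ 𝔽_p[g]ˣ`, `#𝔽_p[g] = p²`).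
* `Serre1972.eq_halfSplitCartan_of_not_dvd_card` — **Cor. to Prop. 11, case (b)**: if `H` acts
  trivially on `𝔽_p²/𝔽_p v`, through a character onto `𝔽_pˣ` on `𝔽_p v`, and `p ∤ #H`
  ("`I_p` opère trivialement"), then `H` *is* a split half-Cartan subgroup ("un groupe cyclique
  d'ordre `p - 1`, représentable matriciellement sous la forme `(* 0; 0 1)`"); the elements of
  `H` fixing `v` are unipotent, hence trivial.
* Transport along a frame: for an `𝔽_p`-plane `A` with an additive frame `e : A ≃+ 𝔽_p²` and
  `Φ : Aut(A) ≅ GL₂(𝔽_p)`, `e (g x) = Φ(g) e(x)`, the frame-free data "a vector `v₀ ≠ 0` with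
  `τ x - x ∈ 𝔽_p v₀` for `τ ∈ I` and `τ v₀ = a v₀` for every `a ∈ 𝔽_pˣ` and some `τ ∈ I`"
  (Prop. 11: `X_p = 𝔽_p v₀`, `χ_Y = 1`, `χ_X` onto) become the matrix hypotheses of
  `exists_halfSplitCartan_le` for `H = Φ(I)`:
  `Serre1972.frame_quot`, `Serre1972.frame_surj`, `Serre1972.exists_halfSplitCartan_le_map`,
  `Serre1972.eq_halfSplitCartan_map_of_not_dvd_card`, and for Prop. 12 c)
  `Serre1972.exists_isField_eq_unitGroup_map_of_isCyclic`.

## References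

* [Serre1972] J.-P. Serre, Invent. Math. 15 (1972) 259–331: §1.11 (Prop. 11, Cor.; Prop. 12 c)),
  §1.12 (Cor. to Prop. 13), §2.1.
-/

open Matrix
open scoped MatrixGroups

namespace Literature.NumberTheory.GaloisRepresentations.Serre1972

variable {p : ℕ}

/-! ### Prop. 12 c): a cyclic subgroup of order `p² - 1` is a non-split Cartan subgroup -/

/-- **A cyclic subgroup of `GL₂(𝔽_p)` of order `p² - 1` is a non-split Cartan subgroup**
(Serre 1972, §1.11, Prop. 12 c): "L'image de `I` dans `GL(E_p)` est un groupe cyclique `C`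
d'ordre `p² - 1` («sous-groupe de Cartan non déployé», cf. n° 2.1)"; n° 2.1 b)).  Proof: for a
generator `g`, `H ⊆ 𝔽_p[g]ˣ` and `#𝔽_p[g] = p²`, so all non-zero elements of the commutative
algebra `𝔽_p[g]` are units: it is a field and `H = 𝔽_p[g]ˣ`.
[cite: Serre1972, §1.11, Prop. 12 c) and §2.1 b)] -/
theorem exists_isField_eq_unitGroup_of_isCyclic [Fact p.Prime] {H : Subgroup (GL (Fin 2) (ZMod p))}
    (hcyc : IsCyclic H) (hcard : Nat.card H = p ^ 2 - 1) :
    ∃ k : Subalgebra (ZMod p) (Matrix (Fin 2) (Fin 2) (ZMod p)), IsField k ∧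
      Module.finrank (ZMod p) k = 2 ∧ H = unitGroup k := by
  classical
  have hp : p.Prime := Fact.out
  obtain ⟨g, hg⟩ := hcyc.exists_generator
  set y : Matrix (Fin 2) (Fin 2) (ZMod p) := (g : GL (Fin 2) (ZMod p)).val with hy
  set k := adjoinElem y with hk
  -- `H ≤ 𝔽_p[g]ˣ`
  have hle : H ≤ unitGroup k := by
    intro h hh
    obtain ⟨n, hn⟩ := Subgroup.mem_zpowers_iff.mp (hg ⟨h, hh⟩)
    have : h = (g : GL (Fin 2) (ZMod p)) ^ n := by
      rw [← Subgroup.coe_zpow, hn]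
    rw [this]
    exact Subgroup.zpow_mem _ (self_mem_adjoinElem y) n
  -- `g` is not scalar (a scalar has order dividing `p - 1 < p² - 1`)
  have hp1 : p - 1 < p ^ 2 - 1 := by
    have h2 := hp.two_le
    have : p < p ^ 2 := by nlinarith
    omega
  have hys : ∀ c : ZMod p, y ≠ c • 1 := by
    intro c hc
    have hc0 : c ≠ 0 := by
      intro h0
      apply GL2.det_ne_zero (g : GL (Fin 2) (ZMod p))
      rw [← hy, hc, h0, zero_smul, Matrix.det_zero]
    have hpow : (g : GL (Fin 2) (ZMod p)) ^ (p - 1) = 1 := by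
      apply Units.ext
      rw [Units.val_pow_eq_pow_val, ← hy, hc, smul_pow, one_pow, ZMod.pow_card_sub_one_eq_one hc0,
        one_smul, Units.val_one]
    have hord : orderOf g ∣ p - 1 := by
      apply orderOf_dvd_of_pow_eq_one
      exact Subtype.ext (by rw [Subgroup.coe_pow, hpow, Subgroup.coe_one])
    have hordg : orderOf g = p ^ 2 - 1 := by rw [orderOf_eq_card_of_forall_mem_zpowers hg, hcard]
    rw [hordg] at hord
    have h2le := hp.two_le
    exact absurd (Nat.le_of_dvd (by omega) hord) (not_le.mpr hp1)
  have h2 : Module.finrank (ZMod p) k = 2 := finrank_adjoinElem hys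
  have hcardk' : Nat.card k = p ^ 2 := card_eq_sq_of_finrank_eq_two h2
  haveI : Finite k := Nat.finite_of_card_ne_zero (by rw [hcardk']; exact pow_ne_zero _ hp.ne_zero)
  haveI : Finite (unitGroup k) := Finite.of_injective _ (unitGroupEquiv k).injective
  -- counting: `#kˣ ≥ p² - 1 = #k - 1`
  have hunits : p ^ 2 - 1 ≤ Nat.card (k)ˣ := by
    rw [← hcard, ← Nat.card_congr (unitGroupEquiv k).toEquiv]
    exact Subgroup.card_le_of_le hle
  -- every non-zero element of `k` is a unit
  have hunit : ∀ a : k, a ≠ 0 → IsUnit a := by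
    intro a ha0
    by_contra ha
    have hsub : Set.range (Units.val : (k)ˣ → k) ⊆ ({0, a} : Set k)ᶜ := by
      rintro _ ⟨u, rfl⟩ hu
      simp only [Set.mem_insert_iff, Set.mem_singleton_iff] at hu
      rcases hu with hu | hu
      · exact u.ne_zero hu
      · exact ha (hu ▸ u.isUnit)
    have h1 : Nat.card (k)ˣ ≤ (({0, a} : Set k)ᶜ).ncard := by
      rw [← Set.ncard_range_of_injective Units.val_injective]
      exact Set.ncard_le_ncard hsub (Set.toFinite _)
    have h2' : (({0, a} : Set k)ᶜ).ncard = p ^ 2 - 2 := by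
      have h3 := Set.ncard_add_ncard_compl ({0, a} : Set k)
      rw [Set.ncard_pair (Ne.symm ha0), hcardk'] at h3
      omega
    have h4 : 2 ≤ p ^ 2 := le_trans hp.two_le (Nat.le_self_pow two_ne_zero p)
    omega
  have hfield : IsField k :=
    { exists_pair_ne := ⟨0, 1, zero_ne_one⟩
      mul_comm := fun m m' ↦ Subtype.ext (mul_comm_of_mem_adjoinElem m.2 m'.2)
      mul_inv_cancel := fun {a} ha ↦ by
        obtain ⟨u, rfl⟩ := hunit a ha
        exact ⟨(u⁻¹ : (k)ˣ), u.mul_inv⟩ }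
  refine ⟨k, hfield, h2, Subgroup.eq_of_le_of_card_ge hle ?_⟩
  rw [card_unitGroup_eq hfield h2, hcard]

/-! ### Cor. to Prop. 11, case (b): `p ∤ #H` forces `H` to be a split half-Cartan subgroup -/

/-- An element of `GL₂(F)` fixing `v ≠ 0` and acting trivially on `F²/F v` is unipotent:
`(h - 1)² = 0`. [folklore] -/
theorem sub_one_mul_sub_one_eq_zero {F : Type*} [Field F] {h : Matrix (Fin 2) (Fin 2) F}
    {v : Fin 2 → F} (hhv : h *ᵥ v = v) (hquot : ∀ w : Fin 2 → F, ∃ b : F, h *ᵥ w - w = b • v) :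
    (h - 1) * (h - 1) = 0 := by
  refine Matrix.ext_iff_mulVec.mpr fun w ↦ ?_
  obtain ⟨b, hb⟩ := hquot w
  have h1 : (h - 1) *ᵥ w = b • v := by rw [Matrix.sub_mulVec, Matrix.one_mulVec, hb]
  have h2 : (h - 1) *ᵥ v = 0 := by rw [Matrix.sub_mulVec, Matrix.one_mulVec, hhv, sub_self]
  rw [← Matrix.mulVec_mulVec, h1, Matrix.mulVec_smul, h2, smul_zero, Matrix.zero_mulVec]

/-- **Cor. to Prop. 11 (b) / Cor. to Prop. 13 (b).**  Let `H ⊆ GL₂(𝔽_p)` act trivially on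
`𝔽_p²/𝔽_p v` (`h w - w ∈ 𝔽_p v`) with character on `𝔽_p v` onto `𝔽_pˣ`, and suppose
`p ∤ #H` ("`I_p` opère trivialement sur `E_p`").  Then `H` is a split half-Cartan subgroup with
respect to a basis whose second vector is `v` ("l'image de `I` dans `GL(E_p)` est un groupe
cyclique d'ordre `p - 1`, représentable matriciellement sous la forme `(* 0; 0 1)`"): `H`
contains such a subgroup (`exists_halfSplitCartan_le`), and `h ↦ h v` is injective on `H` (an
element fixing `v` is unipotent, of order `1` or `p`), so `#H ≤ p - 1`.
[cite: Serre1972, §1.11, Cor. to Prop. 11 (b); §1.12, Cor. to Prop. 13 (b)] -/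
theorem eq_halfSplitCartan_of_not_dvd_card [Fact p.Prime] {H : Subgroup (GL (Fin 2) (ZMod p))}
    {v : Fin 2 → ZMod p} (hv : v ≠ 0)
    (hquot : ∀ h ∈ H, ∀ w : Fin 2 → ZMod p, ∃ b : ZMod p,
      (h : Matrix (Fin 2) (Fin 2) (ZMod p)) *ᵥ w - w = b • v)
    (hsurj : ∀ a : (ZMod p)ˣ, ∃ h ∈ H,
      (h : Matrix (Fin 2) (Fin 2) (ZMod p)) *ᵥ v = (a : ZMod p) • v)
    (hpH : ¬ p ∣ Nat.card H) :
    ∃ P : GL (Fin 2) (ZMod p), (P : Matrix (Fin 2) (Fin 2) (ZMod p)).col 1 = v ∧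
      H = halfSplitCartan P := by
  classical
  have hp : p.Prime := Fact.out
  haveI : Finite H := Nat.finite_of_card_ne_zero (fun h0 ↦ hpH (h0 ▸ dvd_zero p))
  obtain ⟨P, hPv, hle⟩ := exists_halfSplitCartan_le hv hquot hsurj
  refine ⟨P, hPv, (Subgroup.eq_of_le_of_card_ge hle ?_).symm⟩
  rw [card_halfSplitCartan_eq]
  -- an element of `H` fixing `v` is trivial
  have hker : ∀ h ∈ H, (h : Matrix (Fin 2) (Fin 2) (ZMod p)) *ᵥ v = v → h = 1 := by
    intro h hh hhv
    set N : Matrix (Fin 2) (Fin 2) (ZMod p) := (h : Matrix (Fin 2) (Fin 2) (ZMod p)) - 1 with hN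
    have hNN : N * N = 0 := sub_one_mul_sub_one_eq_zero hhv (hquot h hh)
    have hpow : h ^ p = 1 := by
      apply Units.ext
      rw [Units.val_pow_eq_pow_val, show (h : Matrix (Fin 2) (Fin 2) (ZMod p)) = 1 + N by
        rw [hN, add_sub_cancel], DeligneSerre1974.one_add_pow_of_mul_self_eq_zero hNN p,
        ZMod.natCast_self, zero_smul, add_zero, Units.val_one]
    have hord : orderOf (⟨h, hh⟩ : H) ∣ p :=
      orderOf_dvd_of_pow_eq_one (Subtype.ext (by rw [Subgroup.coe_pow, hpow, Subgroup.coe_one]))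
    rcases (Nat.dvd_prime hp).mp hord with h1 | h1
    · exact congrArg Subtype.val (orderOf_eq_one_iff.mp h1)
    · have h2 := orderOf_dvd_natCard (⟨h, hh⟩ : H)
      rw [h1] at h2
      exact absurd h2 hpH
  -- `h ↦ (h v)`: `H → 𝔽_pˣ v` is injective
  have hval : ∀ h ∈ H, ∃ a : (ZMod p)ˣ,
      (h : Matrix (Fin 2) (Fin 2) (ZMod p)) *ᵥ v = (a : ZMod p) • v := by
    intro h hh
    obtain ⟨b, hb⟩ := hquot h hh v
    have h1 : (h : Matrix (Fin 2) (Fin 2) (ZMod p)) *ᵥ v = (1 + b) • v := by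
      rw [add_smul, one_smul, ← hb, add_sub_cancel]
    have hb0 : 1 + b ≠ 0 := by
      intro h0
      rw [h0, zero_smul] at h1
      apply hv
      have := congrArg (fun w ↦ ((h : Matrix (Fin 2) (Fin 2) (ZMod p)))⁻¹ *ᵥ w) h1
      simpa only [Matrix.mulVec_mulVec, Matrix.nonsing_inv_mul _ (GL2.det_ne_zero h).isUnit,
        Matrix.one_mulVec, Matrix.mulVec_zero] using this
    exact ⟨Units.mk0 _ hb0, h1⟩
  choose f hf using hval
  have hinj : Function.Injective fun h : H ↦ f h.1 h.2 := by
    rintro ⟨h, hh⟩ ⟨h', hh'⟩ hff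
    simp only at hff
    have hinv : ((h⁻¹ : GL (Fin 2) (ZMod p)) : Matrix (Fin 2) (Fin 2) (ZMod p)) *ᵥ
        ((f h hh : ZMod p) • v) = v := by
      rw [← hf h hh, Matrix.mulVec_mulVec, Matrix.coe_units_inv,
        Matrix.nonsing_inv_mul _ (GL2.det_ne_zero h).isUnit, Matrix.one_mulVec]
    have h1 : ((h⁻¹ * h' : GL (Fin 2) (ZMod p)) : Matrix (Fin 2) (Fin 2) (ZMod p)) *ᵥ v = v := by
      rw [Units.val_mul, ← Matrix.mulVec_mulVec, hf h' hh', ← hff, hinv]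
    have := hker _ (H.mul_mem (H.inv_mem hh) hh') h1
    exact Subtype.ext (inv_mul_eq_one.mp this)
  calc Nat.card H ≤ Nat.card (ZMod p)ˣ := Nat.card_le_card_of_injective _ hinj
    _ = p - 1 := by rw [Nat.card_eq_fintype_card, ZMod.card_units]

/-! ### Transport along a frame of an `𝔽_p`-plane -/

section Frame

variable {A : Type*} [AddCommGroup A] [Module (ZMod p) A]
  (e : A ≃+ (Fin 2 → ZMod p)) (Φ : Multiplicative (AddAut A) ≃* GL (Fin 2) (ZMod p))
  (he : ∀ (g : Multiplicative (AddAut A)) (x : A),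
    e (Multiplicative.toAdd g x) =
      ((Φ g : GL (Fin 2) (ZMod p)) : Matrix (Fin 2) (Fin 2) (ZMod p)) *ᵥ e x)

include he

-- An additive frame `e` is `𝔽_p`-linear: this is Mathlib's `ZMod.map_smul e b x`
-- (`e (b • x) = b • e x`), used directly below.

/-- Transport of "`τ x - x ∈ 𝔽_p v₀` for all `x`" (`χ_Y = 1`) along a frame: the elements of
`H = Φ(I)` act trivially on `𝔽_p² / 𝔽_p e(v₀)`. [cite: Serre1972, §1.11, Prop. 11] -/
theorem frame_quot {I : Subgroup (Multiplicative (AddAut A))} {v₀ : A}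
    (hquot : ∀ τ ∈ I, ∀ x : A, ∃ b : ZMod p, Multiplicative.toAdd τ x - x = b • v₀) :
    ∀ h ∈ I.map Φ.toMonoidHom, ∀ w : Fin 2 → ZMod p, ∃ b : ZMod p,
      (h : Matrix (Fin 2) (Fin 2) (ZMod p)) *ᵥ w - w = b • e v₀ := by
  rintro _ ⟨τ, hτ, rfl⟩ w
  obtain ⟨b, hb⟩ := hquot τ hτ (e.symm w)
  refine ⟨b, ?_⟩
  have h1 := congrArg e hb
  rw [map_sub, he, AddEquiv.apply_symm_apply, ZMod.map_smul e b v₀] at h1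
  exact h1

/-- Transport of "`τ v₀ = a v₀` for every `a ∈ 𝔽_pˣ` and some `τ ∈ I`" (`χ_X` onto) along a
frame. [cite: Serre1972, §1.11, Prop. 11 and Cor. (a)] -/
theorem frame_surj {I : Subgroup (Multiplicative (AddAut A))} {v₀ : A}
    (hsurj : ∀ a : (ZMod p)ˣ, ∃ τ ∈ I, Multiplicative.toAdd τ v₀ = (a : ZMod p) • v₀) :
    ∀ a : (ZMod p)ˣ, ∃ h ∈ I.map Φ.toMonoidHom,
      (h : Matrix (Fin 2) (Fin 2) (ZMod p)) *ᵥ e v₀ = (a : ZMod p) • e v₀ := by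
  intro a
  obtain ⟨τ, hτ, hτv⟩ := hsurj a
  refine ⟨Φ τ, ⟨τ, hτ, rfl⟩, ?_⟩
  rw [← he, hτv, ZMod.map_smul e (a : ZMod p) v₀]

/-- **Cor. to Prop. 11 through a frame**: `H = Φ(I)` contains a split half-Cartan subgroup of
`GL₂(𝔽_p)` (second basis vector `e v₀`), granted the frame-free data of Prop. 11 for `I`:
`v₀ ≠ 0`, `τ x - x ∈ 𝔽_p v₀`, and `χ_X : I → 𝔽_pˣ` onto.
[cite: Serre1972, §1.11, Cor. to Prop. 11 (b)–(c)] -/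
theorem exists_halfSplitCartan_le_map [Fact p.Prime] {I : Subgroup (Multiplicative (AddAut A))}
    {v₀ : A}
    (hv₀ : v₀ ≠ 0)
    (hquot : ∀ τ ∈ I, ∀ x : A, ∃ b : ZMod p, Multiplicative.toAdd τ x - x = b • v₀)
    (hsurj : ∀ a : (ZMod p)ˣ, ∃ τ ∈ I, Multiplicative.toAdd τ v₀ = (a : ZMod p) • v₀) :
    ∃ P : GL (Fin 2) (ZMod p), (P : Matrix (Fin 2) (Fin 2) (ZMod p)).col 1 = e v₀ ∧
      halfSplitCartan P ≤ I.map Φ.toMonoidHom :=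
  exists_halfSplitCartan_le (fun h0 ↦ hv₀ (e.injective (h0.trans (map_zero e).symm)))
    (frame_quot e Φ he hquot) (frame_surj e Φ he hsurj)

/-- **Cor. to Prop. 11 (b) through a frame**: if moreover `p ∤ #Φ(I)` then `Φ(I)` *is* a split
half-Cartan subgroup. [cite: Serre1972, §1.11, Cor. to Prop. 11 (b)] -/
theorem eq_halfSplitCartan_map_of_not_dvd_card [Fact p.Prime]
    {I : Subgroup (Multiplicative (AddAut A))}
    {v₀ : A} (hv₀ : v₀ ≠ 0)
    (hquot : ∀ τ ∈ I, ∀ x : A, ∃ b : ZMod p, Multiplicative.toAdd τ x - x = b • v₀)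
    (hsurj : ∀ a : (ZMod p)ˣ, ∃ τ ∈ I, Multiplicative.toAdd τ v₀ = (a : ZMod p) • v₀)
    (hpI : ¬ p ∣ Nat.card (I.map Φ.toMonoidHom)) :
    ∃ P : GL (Fin 2) (ZMod p), (P : Matrix (Fin 2) (Fin 2) (ZMod p)).col 1 = e v₀ ∧
      I.map Φ.toMonoidHom = halfSplitCartan P :=
  eq_halfSplitCartan_of_not_dvd_card (fun h0 ↦ hv₀ (e.injective (h0.trans (map_zero e).symm)))
    (frame_quot e Φ he hquot) (frame_surj e Φ he hsurj) hpI

omit [Module (ZMod p) A] he in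
/-- **Prop. 12 c) through a frame**: if `I ≤ Aut(A)` is cyclic of order `p² - 1`, its image
`Φ(I)` is a non-split Cartan subgroup `kˣ` of `GL₂(𝔽_p)`. [cite: Serre1972, §1.11, Prop. 12 c)] -/
theorem exists_isField_eq_unitGroup_map_of_isCyclic [Fact p.Prime]
    {I : Subgroup (Multiplicative (AddAut A))}
    (hcyc : IsCyclic I) (hcard : Nat.card I = p ^ 2 - 1) :
    ∃ k : Subalgebra (ZMod p) (Matrix (Fin 2) (Fin 2) (ZMod p)), IsField k ∧
      Module.finrank (ZMod p) k = 2 ∧ I.map Φ.toMonoidHom = unitGroup k := by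
  have eI : I ≃* I.map Φ.toMonoidHom := I.equivMapOfInjective Φ.toMonoidHom Φ.injective
  refine exists_isField_eq_unitGroup_of_isCyclic
    (isCyclic_of_surjective eI.toMonoidHom eI.surjective) ?_
  rw [← hcard]
  exact (Nat.card_congr eI.toEquiv).symm

end Frame

end Literature.NumberTheory.GaloisRepresentations.Serre1972
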